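import Summits.Ventures.YMGap.RobustBall.PlaquetteActionBridge
import HarnessLib

/-!
# Venture YMGap, track ROBUST-BALL (Y2) — crux Y2-X2 for the FULL tier-1 ball, step 5a: the STAR-WINDOW
# DOOR for a GENERAL specification on the links of `(ℤ/L)^d`, with a boundary of arbitrary radius

HONEST FRAMING. WHAT THIS IS: a venture file (cell `pub-ymgap`, track Y2 ROBUST-BALL, seat ds-2): the tree's
star door `DSWindow.star_abs_covariance_le` (stated there for the torus weight specification of a plaquette weight
and arrays supported within periodic sup-distance `1` of the star's vertex) RE-RUN for (i) ANY specification `γ`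
on the links of the torus and ANY Gibbs measure `μ` of `γ` (the generic `DSWindowCertificate.Certificate`
already allows this), and (ii) arrays supported on boundary links within distance `ρ₀ ≥ 1` of the vertex (the
robust star array of a range-`r` member reaches `ρ₀ = (r ⊔ 1) + 2`): the distance-to-`Δg` profile is divided by
`ρ₀`, so the depth is `⌊L₀/ρ₀⌋`. Output `spec_star_abs_covariance_le`:
`|cov_μ(f, g)| ≤ 4R² exp(−κ₁ ⌊L₀/ρ₀⌋) (Σ δf)(Σ δg)`, `κ₁ = (1−ρ)²/(2(2ρ·2d+1))`; plus the extension lemma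
`isKRContraction_univ_of_le` (a Kantorovich–Rubinstein contraction with finite-range neighbourhoods is one with
all links as neighbours for any dominating nonnegative array) and two link-endpoint distance lemmas (ds-4's `torusNorm_linkEnds_sub_fst_le_one` reused). Consumed by
`RobustStarDoor.lean`. WHAT THIS IS NOT: no array is constructed here and no number; lattice bookkeeping on a
finite torus — nothing about the continuum or the Millennium problem.

## References
* R. L. Dobrushin, S. B. Shlosman (1985); H. Föllmer, LNM 1362 (1988) Ch. I (2.13), (2.23).
* The tree: `Thresholds/DSWindowCertificate.lean`, `Thresholds/StarWindow.lean` (ds-4 / p3; followed line by line).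
-/

noncomputable section

open MeasureTheory ProbabilityTheory Function Finset
open Literature.Probability.LatticeModels
open Literature.Probability.LatticeModels.DobrushinMetric
open Literature.MathematicalPhysics.QuantumFieldTheory
open Literature.MathematicalPhysics.QuantumFieldTheory.Balaban1983to89.StrongCouplingTorusWindow
open Summit.Ventures.YMGap.DSWindow

namespace Summit.Ventures.YMGap.RobustStar

/-! ### Extending a finite-range Kantorovich–Rubinstein contraction to all links as neighbours -/

section Extend

variable {V S : Type*} [MeasurableSpace S] [Fintype V] [DecidableEq V]

/-- **Extension / domination.** A Kantorovich–Rubinstein contraction with neighbourhoods `nbr` and array `C`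
(weight `r ≥ 0`) is one with neighbourhoods `univ ∖ {x}` for every nonnegative array `C'` dominating `C` on
`nbr` (off `nbr x` the one-site law does not see the changed site, so the bound is `0`). [folklore] -/
theorem isKRContraction_univ_of_le {γ : Specification V S} {r : S → S → ℝ} {nbr : V → Finset V}
    {C C' : V → V → ℝ} (hK : IsKRContraction γ r nbr C) (hr : ∀ a b, 0 ≤ r a b) (hC' : ∀ x y, 0 ≤ C' x y)
    (hle : ∀ x, ∀ y ∈ nbr x, C x y ≤ C' x y) :
    IsKRContraction γ r (fun x => univ.erase x) C' := by
  refine ⟨fun x => Finset.notMem_erase x _, hC', fun x η η' h => hK.siteLaw_congr x η η' fun z hz =>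
    h z (mem_erase.2 ⟨fun hzx => hK.not_mem x (hzx ▸ hz), mem_univ _⟩), fun x y hy ω η hωη φ L hφm hφb hL hφL => ?_⟩
  by_cases hyn : y ∈ nbr x
  · exact (hK.contract x y hyn ω η hωη φ L hφm hφb hL hφL).trans
      (mul_le_mul_of_nonneg_right (mul_le_mul_of_nonneg_right (hle x y hyn) hL) (hr _ _))
  · have hlaw : siteLaw γ x ω = siteLaw γ x η :=
      hK.siteLaw_congr x ω η fun z hz => hωη z fun hzy => hyn (hzy ▸ hz)
    rw [hlaw, sub_self, abs_zero]
    exact mul_nonneg (mul_nonneg (hC' x y) hL) (hr _ _)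

end Extend

/-! ### Geometry: endpoints of a link -/

section Geometry

variable {d L : ℕ} [NeZero L]

/-- A star link's base point is within distance `1` of the vertex. [folklore] -/
theorem torusNorm_sub_fst_le_one_of_mem_vertexStar {s : Site d L} {x : Edge d L} (hx : x ∈ vertexStar s) :
    torusNorm (s - x.1) ≤ 1 :=
  Summit.Ventures.YMGap.RobustBall.torusNorm_linkEnds_sub_fst_le_one (mem_vertexStar.1 hx)

omit [NeZero L] in
/-- The base point of a link is within periodic sup-distance `1` of either endpoint. [folklore] -/
theorem torusNorm_fst_sub_linkEnds_le_one {x : Edge d L} {v : Site d L} (hv : v ∈ linkEnds x) :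
    torusNorm (x.1 - v) ≤ 1 := by
  rw [← torusNorm_neg, neg_sub]; exact Summit.Ventures.YMGap.RobustBall.torusNorm_linkEnds_sub_fst_le_one hv

end Geometry

/-! ### The star door for a general specification, boundary radius `ρ₀` -/

section Door

variable {d L : ℕ} [NeZero L] {G : Type*} [MeasurableSpace G]

/-- **THE STAR-WINDOW DOOR for a general specification and boundary radius `ρ₀`.** Let `γ` be a
specification on the links of `(ℤ/L)^d`, `μ` a Gibbs measure of `γ`, `r ≤ R` a nonnegative-bounded weight on
`G`, and `K(s; y → x) ≥ 0` a vertex-indexed array supported on links `y` whose endpoints are within periodic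
sup-distance `ρ₀ ≥ 1` of `s`, satisfying the window contraction (H1) for the star windows of `γ`
(`IsWindowKRContraction γ id (linkWeight r) starWin starWin (K ·.1)`) and the per-star received sum
`Σ_y K(s; y → x) ≤ ρ < 1` for `x ∈ vertexStar s`. Then for admissible link observables `f, g` whose links'
endpoints are `≥ L₀` apart,
`|cov_μ(f, g)| ≤ 4 R² exp(−(1 − ρ)² ⌊L₀/ρ₀⌋ / (2(2ρ·2d + 1))) (Σ δf)(Σ δg)` — `DSWindowCertificate.Certificate`
with `N⋆ = 2d` and the profile `⌊min_{v ∈ ends x} dist(v, ends Δg)/ρ₀⌋`. [folklore] -/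
theorem spec_star_abs_covariance_le {γ : Specification (Edge d L) G} (hγ : IsSpecification γ)
    {μ : Measure (GaugeConfig d L G)} (hμ : IsGibbsMeasure γ μ)
    {r : G → G → ℝ} {R : ℝ} (hR : 0 ≤ R) (hrR : ∀ a b, r a b ≤ R)
    {K : Site d L → Edge d L → Edge d L → ℝ} (hK : ∀ s y x, 0 ≤ K s y x) {ρ₀ : ℕ} (hρ₀ : 1 ≤ ρ₀)
    (hKloc : ∀ s y x, K s y x ≠ 0 → ∀ w ∈ linkEnds y, torusNorm (s - w) ≤ ρ₀)
    (hcontract : IsWindowKRContraction γ (id : Edge d L → Edge d L) (linkWeight r) starWin starWin fun c => K c.1)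
    {ρ : ℝ} (hρ0 : 0 ≤ ρ) (hρ1 : ρ < 1)
    (hsum : ∀ (s : Site d L) (x : Edge d L), x ∈ vertexStar s → ∑ y, K s y x ≤ ρ)
    {f g : GaugeConfig d L G → ℝ} {Δf Δg : Finset (Edge d L)} {δf δg : Edge d L → ℝ}
    (hf : LinkObs r f Δf δf) (hg : LinkObs r g Δg δg) (L₀ : ℕ)
    (hL₀ : ∀ x ∈ Δf, ∀ z ∈ Δg, ∀ a ∈ linkEnds x, ∀ w ∈ linkEnds z, L₀ ≤ torusNorm (a - w)) :
    |cov[f, g; μ]| ≤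
      4 * R ^ 2 * Real.exp (-((1 - ρ) ^ 2 / (2 * (2 * ρ * (2 * d : ℕ) + 1)) * (L₀ / ρ₀ : ℕ))) *
        (∑ x ∈ Δf, δf x) * ∑ y ∈ Δg, δg y := by
  classical
  -- the certificate, as a local term
  obtain ⟨C, hC⟩ : ∃ C : Certificate γ (id : Edge d L → Edge d L), C =
      { w := linkWeight r, R := R, Λ := starWin, win := starWin, Nstar := 2 * d, k := fun c => K c.1, γ₀ := ρ,
        R_nonneg := hR, w_le := fun _ _ _ => hrR _ _,
        w_local := fun c σ σ' τ τ' hσ hτ => by simp only [linkWeight, hσ c rfl, hτ c rfl],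
        mem_iff := fun _ _ => Iff.rfl, self_mem := self_mem_starWin, card_le := card_filter_mem_starWin_le,
        k_nonneg := fun c y x => hK c.1 y x, contract := hcontract, γ₀_nonneg := hρ0, γ₀_lt_one := hρ1,
        receivedSum := isDSReceivedSum_starWin hsum } := ⟨_, rfl⟩
  have hw : C.w = linkWeight r := by rw [hC]
  have hRC : C.R = R := by rw [hC]
  have hrate : C.rate = (1 - ρ) ^ 2 / (2 * (2 * ρ * (2 * d : ℕ) + 1)) := by rw [hC]; rfl
  have hwin : ∀ c x, x ∈ C.win c ↔ c.1 ∈ linkEnds x := by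
    intro c x; rw [hC]; exact mem_starWin
  have hkC : ∀ c y x, C.k c y x ≠ 0 → ∀ w ∈ linkEnds y, torusNorm (c.1 - w) ≤ ρ₀ := by
    intro c y x hk
    rw [hC] at hk
    exact hKloc _ _ _ hk
  have key : ∀ ℓ : Edge d L → ℕ, C.Profile Δf Δg ℓ (L₀ / ρ₀) →
      |cov[f, g; μ]| ≤
        4 * R ^ 2 * Real.exp (-((1 - ρ) ^ 2 / (2 * (2 * ρ * (2 * d : ℕ) + 1)) * (L₀ / ρ₀ : ℕ))) *
          (∑ x ∈ Δf, δf x) * ∑ y ∈ Δg, δg y := by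
    intro ℓ hℓ
    have h := C.abs_covariance_le hγ hμ (hf.obs C hw) (hg.obs C hw) hℓ
    rw [hRC, hrate] at h
    exact h
  rcases Δg.eq_empty_or_nonempty with hΔg | hne
  · refine key (fun _ => L₀ / ρ₀) ⟨fun x hx c hxc z hzc hzg => ?_, fun c x y _ _ => Nat.le_succ _, fun x _ => le_rfl⟩
    rw [hΔg] at hzg
    exact absurd hzg (Finset.notMem_empty z)
  · -- the distance-to-`Δg` function on sites and its `ρ₀`-scaled link profile
    set D : Site d L → ℕ := fun s => Δg.inf' hne fun z => (linkEnds z).inf' (linkEnds_nonempty z)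
      fun w => torusNorm (s - w) with hD
    have hD0 : ∀ z ∈ Δg, ∀ w ∈ linkEnds z, D w = 0 := by
      intro z hz w hw
      apply Nat.eq_zero_of_le_zero
      calc D w ≤ (linkEnds z).inf' (linkEnds_nonempty z) fun w' => torusNorm (w - w') := Finset.inf'_le _ hz
        _ ≤ torusNorm (w - w) := Finset.inf'_le _ hw
        _ = 0 := by rw [sub_self, torusNorm_zero]
    have hDlip : ∀ s w, D s ≤ D w + torusNorm (s - w) := by
      intro s w
      obtain ⟨z, hz, hzeq⟩ := Finset.exists_mem_eq_inf' hne fun z =>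
        (linkEnds z).inf' (linkEnds_nonempty z) fun w' => torusNorm (w - w')
      obtain ⟨w', hw', hweq⟩ := Finset.exists_mem_eq_inf' (linkEnds_nonempty z) fun w' => torusNorm (w - w')
      have hDw : D w = torusNorm (w - w') := by rw [hD]; exact hzeq.trans hweq
      rw [hDw]
      calc D s ≤ (linkEnds z).inf' (linkEnds_nonempty z) fun w'' => torusNorm (s - w'') := Finset.inf'_le _ hz
        _ ≤ torusNorm (s - w') := Finset.inf'_le _ hw'
        _ ≤ torusNorm (s - w) + torusNorm (w - w') := torusNorm_sub_le _ _ _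
        _ = torusNorm (w - w') + torusNorm (s - w) := add_comm _ _
    have hDL : ∀ x ∈ Δf, ∀ v ∈ linkEnds x, L₀ ≤ D v := fun x hx v hv =>
      Finset.le_inf' _ _ fun z hz => Finset.le_inf' _ _ fun w hw => hL₀ x hx z hz v hv w hw
    refine key (fun x => ((linkEnds x).inf' (linkEnds_nonempty x) D) / ρ₀) ⟨?_, ?_, ?_⟩
    · -- windows around links of positive profile avoid `Δg`
      intro x hx c hxc z hzc hzg
      have h1 : c.1 ∈ linkEnds x := (hwin c x).1 hxc
      have h2 : c.1 ∈ linkEnds z := (hwin c z).1 hzc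
      apply hx
      have h0 : (linkEnds x).inf' (linkEnds_nonempty x) D = 0 := by
        apply Nat.eq_zero_of_le_zero
        calc (linkEnds x).inf' (linkEnds_nonempty x) D ≤ D c.1 := Finset.inf'_le _ h1
          _ = 0 := hD0 z hzg c.1 h2
      rw [h0, Nat.zero_div]
    · -- one step of influence lowers the profile by at most one
      intro c x y hxc hk
      have h1 : c.1 ∈ linkEnds x := (hwin c x).1 hxc
      obtain ⟨w, hw, hweq⟩ := Finset.exists_mem_eq_inf' (linkEnds_nonempty y) D
      show (linkEnds x).inf' (linkEnds_nonempty x) D / ρ₀ ≤ (linkEnds y).inf' (linkEnds_nonempty y) D / ρ₀ + 1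
      rw [hweq]
      have hstep : (linkEnds x).inf' (linkEnds_nonempty x) D ≤ D w + ρ₀ :=
        calc (linkEnds x).inf' (linkEnds_nonempty x) D ≤ D c.1 := Finset.inf'_le _ h1
          _ ≤ D w + torusNorm (c.1 - w) := hDlip _ _
          _ ≤ D w + ρ₀ := Nat.add_le_add_left (hkC c y x hk w hw) _
      calc (linkEnds x).inf' (linkEnds_nonempty x) D / ρ₀ ≤ (D w + ρ₀) / ρ₀ := Nat.div_le_div_right hstep
        _ = D w / ρ₀ + 1 := Nat.add_div_right _ (by omega)
    · -- the profile is `≥ L₀/ρ₀` on `Δf`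
      intro x hx
      exact Nat.div_le_div_right (Finset.le_inf' _ _ fun a ha => hDL x hx a ha)

end Door

end Summit.Ventures.YMGap.RobustStar

end
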